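import Literature.Analysis.FluidPDE.LuoHouSeriesAnsatzResonant
import HarnessLib

/-!
# Chae–Tsai 2015, Theorem 2 on the shrinking window `𝒲_{δ(t)}` (print's second region)

Analysis/FluidPDE proof file (theorems only: no definitions, no named facts, no `sorry`), the
continuation of `LuoHouSeriesAnsatz.lean` (p563152: Theorem 2 on the cone `𝒞_{δ,T}`, `γ ≠ 2`),
`LuoHouSeriesAnsatzResonant.lean` (p566363: `γ = 2`, hence every `γ > 0`, on the cone) and
`LuoHouSeriesAnsatzEngines.lean` (p561956). Print states Theorem 2 "in either the set `𝒞_{δ,T}`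
[…] or in the set `𝒲_{δ(t)}`"; this file types the second alternative.

## Source (held; `p.` = arXiv pages)

D. Chae, T.-P. Tsai, *Remark on Luo–Hou's ansatz for a self-similar solution to the 3D Euler
equations*, J. Nonlinear Sci. **25** (2015) 193–202 = arXiv:1402.4560 [`ChaeTsai2015`]:
§2 (p. 4) "or in the region `𝒲_{δ(t)} := {(r,z,t) | 1 − δ(t) < r < 1, −δ(t) < z < δ(t), T₀ < t < T}`
where `δ(t) > 0` is a decreasing function of `t ∈ (T₀, T)` […] and `lim_{t→T₋} δ(t) = 0`,
`limsup_{t→T₋} (T−t)^{−γ} δ(t) = ∞`"; §3 Theorem 2 (p. 5) and its proof (p. 5–6).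

## Contents

* `series_substitution_at_window` — the three generating identities of
  `series_substitution_at_scale` (all orders (19k)–(21k) at once, polynomial in the scale
  `s = (T−t)^γ`) at an ADMISSIBLE TIME of the window: p563152's series bookkeeping combined with
  the one-sided-in-time reading of p555925's `LuoHouAnsatz.substitution_at_window` (the window at
  time `t` contains the point at all earlier times, so `∂_t` is read on `𝓝[≤] t` under the
  classical-in-time hypothesis `hdiff`).
* `profiles_trivial_of_identities` — the order induction of Theorem 2 with the SCALE SUPPLY
  abstracted into a hypothesis (identities on an interval of scales at every interior point):
  Engines A, A′, B (p561956) and C (p566363) by name; stated once so that both regions use it.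
* `chaeTsai2015_seriesAnsatz_trivial_of_window` — **Theorem 2 on `𝒲_{δ(t)}`, finite order,
  every `γ > 0`** (`γ = 2` under (3.10) for `U₀`, as in `…_of_integralDecay`): the window's
  `limsup` condition supplies, at each interior profile point, admissible scales below every
  `ε > 0` — an infinite set on which the identities hold; each identity is the evaluation of an
  explicit real polynomial in `s` (`exists_poly_swirl/vorticity/stream`, the generating
  polynomials of `order_swirl/vorticity/stream`), so it holds at every scale
  (`Polynomial.eq_zero_of_infinite_isRoot`), and the induction applies.

## What is typed, and how it differs from print (disclosed; never silently stronger)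

As in the cone files: finitely many orders `k < N` (any `N`; the formal infinite series of print
stays `TODO(general form)` — it needs a convergence convention print does not state); `U_k, Ω_k ∈
C¹`, `Ψ_k ∈ C²` on an open neighbourhood of the closed half-plane; (3.10) for `U₀` only and only
at `γ = 2`, on the sup-norm annulus (a WEAKER hypothesis set than print's); the printed gap
"`a = 0`" closed one order later. Window-specific: `δ` is assumed non-increasing on `(T₀, T)`
(print: "decreasing") and `limsup (T−t)^{−γ}δ(t) = ∞` is rendered as "for every `M` and every
`t₁ < T` there is `t ∈ (t₁, T)`, `t > T₀`, with `M (T−t)^γ < δ(t)`"; print's `δ(t) → 0` and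
`δ > 0` are NOT needed; "classical solution" supplies the time-differentiability `hdiff` of
`u₁(·, q)`, `ω₁(·, q)` on the window (as in p555925), used only for the one-sided derivative.

## What this is NOT

Not a statement about Navier–Stokes and not about Luo–Hou's or Chen–Hou's computations or about
asymptotically self-similar blow-up: an EXACT finite-order generalized self-similar expansion in
the Luo–Hou gauge imposed on a window shrinking to the ring SLOWER than the self-similar rate
(`limsup (T−t)^{−γ}δ(t) = ∞`), with the wall condition and the stated decay, carries no swirl
and no vorticity. A window shrinking AT the self-similar rate is exactly what print (abstract)
leaves open: "the self-similar ansatz may be valid […] only in a time-dependent region which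
shrinks to the boundary circle at the self-similar rate".

Tree decls reused by name: `substitution_corr`, `hasDerivAt_series_time`, `order_swirl`,
`order_vorticity`, `order_stream` (p563152); Engines A/A′/B (p561956), C (p566363);
`GeneralizedAxisymNS`, `derivR`, `derivZ`. The half-plane / finite-sum / generating-polynomial
helpers of those files are `private` there and are repeated here (also `private`).

## References

* D. Chae, T.-P. Tsai, J. Nonlinear Sci. 25 (2015) 193–202, doi:10.1007/s00332-014-9225-6,
  arXiv:1402.4560: §2 regions (thm2region2)–(thm2region2b) (p. 4), §3 Theorem 2 and proof
  (p. 5–6). [ChaeTsai2015]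
* G. Luo, T. Y. Hou, arXiv:1310.0497, §4.6–4.7 (the shrinking region of self-similarity
  `D_∞(t)` addressed). [LuoHou2014]
* T. Y. Hou, arXiv:2405.10916, §2 (the `(u₁, ω₁, ψ₁)` variables = `GeneralizedAxisymNS`). [Hou2026]
-/

noncomputable section

open Set Function Filter Polynomial MeasureTheory
open scoped Topology ContDiff

namespace Literature.Analysis.FluidPDE

namespace LuoHouSeries

/-! ### Generic lemma 1: generating polynomials, and identities on an infinite set of scales -/

section Poly2

variable {N : ℕ} {U Ω Ψ : ℕ → ℝ × ℝ → ℝ} {γ : ℝ} {Y : ℝ × ℝ}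

/-- Evaluation of a truncated generating polynomial `Σ_{l<N} a_l X^l`. [folklore] -/
private theorem eval_genPoly (N : ℕ) (a : ℕ → ℝ) (s : ℝ) :
    (∑ l ∈ Finset.range N, monomial l (a l)).eval s = ∑ l ∈ Finset.range N, s ^ l * a l := by
  rw [eval_finsetSum]
  refine Finset.sum_congr rfl fun l _ => ?_
  rw [eval_monomial, mul_comm]

/-- Linear recombination of finite sums (three families). [folklore] -/
private theorem sum_shape3 (N : ℕ) (f g h : ℕ → ℝ) (a b c : ℝ) :
    ∑ k ∈ Finset.range N, (a * f k + b * g k + c * h k) =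
      a * (∑ k ∈ Finset.range N, f k) + b * (∑ k ∈ Finset.range N, g k) +
        c * (∑ k ∈ Finset.range N, h k) := by
  rw [Finset.sum_add_distrib, Finset.sum_add_distrib, Finset.mul_sum, Finset.mul_sum, Finset.mul_sum]

/-- A polynomial function vanishing on an infinite set vanishes everywhere. [folklore] -/
private theorem eval_eq_zero_of_infinite {P : ℝ[X]} {A : Set ℝ} (hA : A.Infinite)
    (h : ∀ s ∈ A, P.eval s = 0) (s : ℝ) : P.eval s = 0 := by
  have hP : P = 0 := P.eq_zero_of_infinite_isRoot (hA.mono fun s hs => h s hs)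
  rw [hP, eval_zero]

/-- A set of positive reals with arbitrarily small elements is infinite. [folklore] -/
private theorem infinite_of_forall_exists_lt_pos {A : Set ℝ} (hpos : ∀ s ∈ A, 0 < s)
    (h : ∀ ε : ℝ, 0 < ε → ∃ s ∈ A, s < ε) : A.Infinite := by
  intro hfin
  obtain ⟨s₁, hs₁, -⟩ := h 1 one_pos
  obtain ⟨m, hm, hmin⟩ := Set.exists_min_image A id hfin ⟨s₁, hs₁⟩
  obtain ⟨s, hs, hlt⟩ := h m (hpos m hm)
  exact absurd (hmin s hs) (not_le.2 hlt)

/-- **The swirl generating identity is polynomial in the scale** (explicit generating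
polynomial, as in `order_swirl`). [folklore] -/
private theorem exists_poly_swirl : ∃ P : ℝ[X], ∀ s : ℝ, P.eval s =
      (∑ k ∈ Finset.range N, s ^ k * ((1 - γ / 2 - k * γ) * U k Y)) +
        γ * (Y.1 * (∑ k ∈ Finset.range N, s ^ k * derivR (U k) Y) +
          Y.2 * (∑ k ∈ Finset.range N, s ^ k * derivZ (U k) Y)) +
        (-(∑ k ∈ Finset.range N, s ^ k * derivZ (Ψ k) Y) *
            (∑ k ∈ Finset.range N, s ^ k * derivR (U k) Y) +
          (∑ k ∈ Finset.range N, s ^ k * derivR (Ψ k) Y) *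
            (∑ k ∈ Finset.range N, s ^ k * derivZ (U k) Y)) +
      s * (Y.1 * (-(∑ k ∈ Finset.range N, s ^ k * derivZ (Ψ k) Y) *
            (∑ k ∈ Finset.range N, s ^ k * derivR (U k) Y) +
          (∑ k ∈ Finset.range N, s ^ k * derivR (Ψ k) Y) *
            (∑ k ∈ Finset.range N, s ^ k * derivZ (U k) Y)) +
        2 * (∑ k ∈ Finset.range N, s ^ k * Ψ k Y) *
          (∑ k ∈ Finset.range N, s ^ k * derivZ (U k) Y) -
        2 * (∑ k ∈ Finset.range N, s ^ k * U k Y) *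
          (∑ k ∈ Finset.range N, s ^ k * derivZ (Ψ k) Y)) := by
  set PU : ℝ[X] := ∑ l ∈ Finset.range N, monomial l (U l Y) with hPU
  set PRU : ℝ[X] := ∑ l ∈ Finset.range N, monomial l (derivR (U l) Y) with hPRU
  set PZU : ℝ[X] := ∑ l ∈ Finset.range N, monomial l (derivZ (U l) Y) with hPZU
  set PΨ : ℝ[X] := ∑ l ∈ Finset.range N, monomial l (Ψ l Y) with hPΨ
  set PRΨ : ℝ[X] := ∑ l ∈ Finset.range N, monomial l (derivR (Ψ l) Y) with hPRΨ
  set PZΨ : ℝ[X] := ∑ l ∈ Finset.range N, monomial l (derivZ (Ψ l) Y) with hPZΨ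
  set AU : ℝ[X] := ∑ l ∈ Finset.range N, monomial l ((1 - γ / 2 - l * γ) * U l Y +
    γ * (Y.1 * derivR (U l) Y + Y.2 * derivZ (U l) Y)) with hAU
  refine ⟨AU + (1 + C Y.1 * X) * (-PZΨ * PRU + PRΨ * PZU) + C 2 * X * (PΨ * PZU - PU * PZΨ),
    fun s => ?_⟩
  have eA : AU.eval s = (1 : ℝ) * (∑ k ∈ Finset.range N, s ^ k * ((1 - γ / 2 - k * γ) * U k Y)) +
      γ * Y.1 * (∑ k ∈ Finset.range N, s ^ k * derivR (U k) Y) +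
      γ * Y.2 * (∑ k ∈ Finset.range N, s ^ k * derivZ (U k) Y) := by
    rw [hAU, eval_genPoly, ← sum_shape3]
    exact Finset.sum_congr rfl fun k _ => by ring
  simp only [eval_add, eval_mul, eval_sub, eval_neg, eval_C, eval_X, eval_one,
    hPU, hPRU, hPZU, hPΨ, hPRΨ, hPZΨ, eval_genPoly]
  rw [eA]; ring

/-- **The vorticity generating identity is polynomial in the scale** (as in `order_vorticity`).
[folklore] -/
private theorem exists_poly_vorticity : ∃ P : ℝ[X], ∀ s : ℝ, P.eval s =
      (∑ k ∈ Finset.range N, s ^ k * ((1 - k * γ) * Ω k Y)) +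
        γ * (Y.1 * (∑ k ∈ Finset.range N, s ^ k * derivR (Ω k) Y) +
          Y.2 * (∑ k ∈ Finset.range N, s ^ k * derivZ (Ω k) Y)) +
        (-(∑ k ∈ Finset.range N, s ^ k * derivZ (Ψ k) Y) *
            (∑ k ∈ Finset.range N, s ^ k * derivR (Ω k) Y) +
          (∑ k ∈ Finset.range N, s ^ k * derivR (Ψ k) Y) *
            (∑ k ∈ Finset.range N, s ^ k * derivZ (Ω k) Y)) -
        2 * (∑ k ∈ Finset.range N, s ^ k * U k Y) *
          (∑ k ∈ Finset.range N, s ^ k * derivZ (U k) Y) +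
      s * (Y.1 * (-(∑ k ∈ Finset.range N, s ^ k * derivZ (Ψ k) Y) *
            (∑ k ∈ Finset.range N, s ^ k * derivR (Ω k) Y) +
          (∑ k ∈ Finset.range N, s ^ k * derivR (Ψ k) Y) *
            (∑ k ∈ Finset.range N, s ^ k * derivZ (Ω k) Y)) +
        2 * (∑ k ∈ Finset.range N, s ^ k * Ψ k Y) *
          (∑ k ∈ Finset.range N, s ^ k * derivZ (Ω k) Y)) := by
  set PU : ℝ[X] := ∑ l ∈ Finset.range N, monomial l (U l Y) with hPU
  set PZU : ℝ[X] := ∑ l ∈ Finset.range N, monomial l (derivZ (U l) Y) with hPZU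
  set PRΩ : ℝ[X] := ∑ l ∈ Finset.range N, monomial l (derivR (Ω l) Y) with hPRΩ
  set PZΩ : ℝ[X] := ∑ l ∈ Finset.range N, monomial l (derivZ (Ω l) Y) with hPZΩ
  set PΨ : ℝ[X] := ∑ l ∈ Finset.range N, monomial l (Ψ l Y) with hPΨ
  set PRΨ : ℝ[X] := ∑ l ∈ Finset.range N, monomial l (derivR (Ψ l) Y) with hPRΨ
  set PZΨ : ℝ[X] := ∑ l ∈ Finset.range N, monomial l (derivZ (Ψ l) Y) with hPZΨ
  set AΩ : ℝ[X] := ∑ l ∈ Finset.range N, monomial l ((1 - l * γ) * Ω l Y +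
    γ * (Y.1 * derivR (Ω l) Y + Y.2 * derivZ (Ω l) Y)) with hAΩ
  refine ⟨AΩ + (1 + C Y.1 * X) * (-PZΨ * PRΩ + PRΨ * PZΩ) - C 2 * (PU * PZU) +
    C 2 * X * (PΨ * PZΩ), fun s => ?_⟩
  have eA : AΩ.eval s = (1 : ℝ) * (∑ k ∈ Finset.range N, s ^ k * ((1 - k * γ) * Ω k Y)) +
      γ * Y.1 * (∑ k ∈ Finset.range N, s ^ k * derivR (Ω k) Y) +
      γ * Y.2 * (∑ k ∈ Finset.range N, s ^ k * derivZ (Ω k) Y) := by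
    rw [hAΩ, eval_genPoly, ← sum_shape3]
    exact Finset.sum_congr rfl fun k _ => by ring
  simp only [eval_add, eval_mul, eval_sub, eval_neg, eval_C, eval_X, eval_one,
    hPU, hPZU, hPRΩ, hPZΩ, hPΨ, hPRΨ, hPZΨ, eval_genPoly]
  rw [eA]; ring

/-- **The stream generating identity is polynomial in the scale** (as in `order_stream`).
[folklore] -/
private theorem exists_poly_stream : ∃ P : ℝ[X], ∀ s : ℝ, P.eval s =
      -(∑ k ∈ Finset.range N, s ^ k * (derivR (derivR (Ψ k)) Y + derivZ (derivZ (Ψ k)) Y)) -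
        (∑ k ∈ Finset.range N, s ^ k * Ω k Y) +
      s * (-(Y.1 * (∑ k ∈ Finset.range N, s ^ k *
          (derivR (derivR (Ψ k)) Y + derivZ (derivZ (Ψ k)) Y))) -
        3 * (∑ k ∈ Finset.range N, s ^ k * derivR (Ψ k) Y) -
        Y.1 * (∑ k ∈ Finset.range N, s ^ k * Ω k Y)) := by
  set PΔ : ℝ[X] := ∑ l ∈ Finset.range N,
    monomial l (derivR (derivR (Ψ l)) Y + derivZ (derivZ (Ψ l)) Y) with hPΔ
  set PRΨ : ℝ[X] := ∑ l ∈ Finset.range N, monomial l (derivR (Ψ l) Y) with hPRΨ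
  set PΩ : ℝ[X] := ∑ l ∈ Finset.range N, monomial l (Ω l Y) with hPΩ
  refine ⟨-((1 + C Y.1 * X) * PΔ) - C 3 * X * PRΨ - (1 + C Y.1 * X) * PΩ, fun s => ?_⟩
  simp only [eval_add, eval_mul, eval_sub, eval_neg, eval_C, eval_X, eval_one,
    hPΔ, hPRΨ, hPΩ, eval_genPoly]
  ring

end Poly2

/-! ### Generic lemma 2: half-plane calculus (the helpers of the earlier files are private) -/

section HalfPlaneCalculus4

variable {O : Set (ℝ × ℝ)} {G : ℝ × ℝ → ℝ} {n : WithTop ℕ∞}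

/-- Differentiability at points of an open set carrying a `Cⁿ` function, `n ≠ 0`. [folklore] -/
private theorem differentiableAt_of_contDiffOn_open (hG : ContDiffOn ℝ n G O) (hO : IsOpen O)
    (hn : n ≠ 0) {Y : ℝ × ℝ} (hY : Y ∈ O) : DifferentiableAt ℝ G Y :=
  (hG.differentiableOn hn).differentiableAt (hO.mem_nhds hY)

/-- `∂_R` of a `C²` function is `C¹` on the open set. [folklore] -/
private theorem contDiffOn_derivR_open (hG : ContDiffOn ℝ 2 G O) (hO : IsOpen O) :
    ContDiffOn ℝ 1 (derivR G) O := by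
  have h : ContDiffOn ℝ 1 (fderiv ℝ G) O := hG.fderiv_of_isOpen hO le_rfl
  have e : derivR G = fun q => fderiv ℝ G q (1, 0) := funext fun q => derivR_apply G q
  rw [e]
  exact h.clm_apply contDiffOn_const

/-- `∂_Z` of a `C²` function is `C¹` on the open set. [folklore] -/
private theorem contDiffOn_derivZ_open (hG : ContDiffOn ℝ 2 G O) (hO : IsOpen O) :
    ContDiffOn ℝ 1 (derivZ G) O := by
  have h : ContDiffOn ℝ 1 (fderiv ℝ G) O := hG.fderiv_of_isOpen hO le_rfl
  have e : derivZ G = fun q => fderiv ℝ G q (0, 1) := funext fun q => derivZ_apply G q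
  rw [e]
  exact h.clm_apply contDiffOn_const

/-- `∂_R` of a `C¹` function is continuous on the open set. [folklore] -/
private theorem continuousOn_derivR_open (hG : ContDiffOn ℝ 1 G O) (hO : IsOpen O) :
    ContinuousOn (derivR G) O := by
  have h : ContinuousOn (fderiv ℝ G) O := hG.continuousOn_fderiv_of_isOpen hO le_rfl
  have e : derivR G = fun q => fderiv ℝ G q (1, 0) := funext fun q => derivR_apply G q
  rw [e]
  exact h.clm_apply continuousOn_const

/-- `∂_Z` of a `C¹` function is continuous on the open set. [folklore] -/
private theorem continuousOn_derivZ_open (hG : ContDiffOn ℝ 1 G O) (hO : IsOpen O) :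
    ContinuousOn (derivZ G) O := by
  have h : ContinuousOn (fderiv ℝ G) O := hG.continuousOn_fderiv_of_isOpen hO le_rfl
  have e : derivZ G = fun q => fderiv ℝ G q (0, 1) := funext fun q => derivZ_apply G q
  rw [e]
  exact h.clm_apply continuousOn_const

/-- `∂_R` only depends on the germ. [folklore] -/
private theorem derivR_congr_nhds {f g : ℝ × ℝ → ℝ} {Y : ℝ × ℝ} (h : f =ᶠ[𝓝 Y] g) :
    derivR f Y = derivR g Y := by
  rw [derivR_apply, h.fderiv_eq, derivR_apply]

/-- `∂_Z` only depends on the germ. [folklore] -/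
private theorem derivZ_congr_nhds {f g : ℝ × ℝ → ℝ} {Y : ℝ × ℝ} (h : f =ᶠ[𝓝 Y] g) :
    derivZ f Y = derivZ g Y := by
  rw [derivZ_apply, h.fderiv_eq, derivZ_apply]

/-- A function continuous at a wall point and constant on the open half-plane takes that value at
the wall point. [folklore] -/
private theorem eq_at_wall_of_eq_on_open {h : ℝ × ℝ → ℝ} {c : ℝ} {Z : ℝ} (hh : ContinuousAt h (0, Z))
    (hc : ∀ Y : ℝ × ℝ, Y.1 < 0 → h Y = c) : h (0, Z) = c := by
  have hcurve : Tendsto (fun r : ℝ => ((r, Z) : ℝ × ℝ)) (𝓝[<] 0) (𝓝 (0, Z)) := by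
    have : Continuous fun r : ℝ => ((r, Z) : ℝ × ℝ) := continuous_id.prodMk continuous_const
    exact (this.tendsto' 0 (0, Z) rfl).mono_left nhdsWithin_le_nhds
  have h1 : Tendsto (fun r : ℝ => h (r, Z)) (𝓝[<] 0) (𝓝 (h (0, Z))) := hh.tendsto.comp hcurve
  have h2 : Tendsto (fun r : ℝ => h (r, Z)) (𝓝[<] 0) (𝓝 c) := by
    refine tendsto_const_nhds.congr' ?_
    filter_upwards [self_mem_nhdsWithin] with r hr
    exact (hc (r, Z) hr).symm
  exact tendsto_nhds_unique h1 h2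

/-- A `C¹` function on an open neighbourhood of the closed half-plane that vanishes on the closed
half-plane has vanishing partials there. [folklore] -/
private theorem derivR_derivZ_eq_zero_of_eq_zero (hO : IsOpen O) (hHO : {Y : ℝ × ℝ | Y.1 ≤ 0} ⊆ O)
    (hG : ContDiffOn ℝ 1 G O) (h0 : ∀ Y : ℝ × ℝ, Y.1 ≤ 0 → G Y = 0) {Y : ℝ × ℝ} (hY : Y.1 ≤ 0) :
    derivR G Y = 0 ∧ derivZ G Y = 0 := by
  have hopen : ∀ Y' : ℝ × ℝ, Y'.1 < 0 → derivR G Y' = 0 ∧ derivZ G Y' = 0 := by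
    intro Y' hY'
    have hev : G =ᶠ[𝓝 Y'] fun _ => (0 : ℝ) := by
      have ho : IsOpen {q : ℝ × ℝ | q.1 < 0} := isOpen_lt continuous_fst continuous_const
      filter_upwards [ho.mem_nhds hY'] with q hq
      exact h0 q hq.le
    rw [derivR_apply, derivZ_apply, hev.fderiv_eq]
    simp
  rcases hY.lt_or_eq with hlt | heq
  · exact hopen Y hlt
  · have hYO : Y ∈ O := hHO hY
    have hcR : ContinuousAt (derivR G) Y := (continuousOn_derivR_open hG hO).continuousAt (hO.mem_nhds hYO)
    have hcZ : ContinuousAt (derivZ G) Y := (continuousOn_derivZ_open hG hO).continuousAt (hO.mem_nhds hYO)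
    have eY : Y = (0, Y.2) := by ext <;> simp [heq]
    rw [eY] at hcR hcZ ⊢
    exact ⟨eq_at_wall_of_eq_on_open hcR fun Y' h => (hopen Y' h).1,
      eq_at_wall_of_eq_on_open hcZ fun Y' h => (hopen Y' h).2⟩

/-- One-sided time derivatives: if `f` and `g` are differentiable at `t` and agree on a left
neighbourhood, their derivatives agree. [folklore] -/
private theorem deriv_eq_of_eventuallyEq_nhdsLE {f g : ℝ → ℝ} {t : ℝ} (hf : DifferentiableAt ℝ f t)
    (hg : DifferentiableAt ℝ g t) (h : f =ᶠ[𝓝[≤] t] g) : deriv f t = deriv g t := by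
  rw [← hf.derivWithin (uniqueDiffWithinAt_Iic t), ← hg.derivWithin (uniqueDiffWithinAt_Iic t)]
  exact h.derivWithin_eq (h.self_of_nhdsWithin (mem_Iic.2 le_rfl))

end HalfPlaneCalculus4

section Series2

variable {N : ℕ} {G : ℕ → ℝ × ℝ → ℝ}

/-- `∂_R` of a finite linear combination of profiles. [folklore] -/
private theorem derivR_finsum (c : ℕ → ℝ) {Y : ℝ × ℝ}
    (hG : ∀ k ∈ Finset.range N, DifferentiableAt ℝ (G k) Y) :
    derivR (fun q => ∑ k ∈ Finset.range N, c k * G k q) Y =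
      ∑ k ∈ Finset.range N, c k * derivR (G k) Y := by
  have h : HasFDerivAt (fun q => ∑ k ∈ Finset.range N, c k * G k q)
      (∑ k ∈ Finset.range N, c k • fderiv ℝ (G k) Y) Y :=
    HasFDerivAt.fun_sum fun k hk => ((hG k hk).hasFDerivAt.const_mul (c k))
  rw [derivR_apply, h.fderiv, FunLike.coe_sum, Finset.sum_apply]
  refine Finset.sum_congr rfl fun k _ => ?_
  rw [FunLike.coe_smul, Pi.smul_apply, derivR_apply, smul_eq_mul]

/-- `∂_Z` of a finite linear combination of profiles. [folklore] -/
private theorem derivZ_finsum (c : ℕ → ℝ) {Y : ℝ × ℝ}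
    (hG : ∀ k ∈ Finset.range N, DifferentiableAt ℝ (G k) Y) :
    derivZ (fun q => ∑ k ∈ Finset.range N, c k * G k q) Y =
      ∑ k ∈ Finset.range N, c k * derivZ (G k) Y := by
  have h : HasFDerivAt (fun q => ∑ k ∈ Finset.range N, c k * G k q)
      (∑ k ∈ Finset.range N, c k • fderiv ℝ (G k) Y) Y :=
    HasFDerivAt.fun_sum fun k hk => ((hG k hk).hasFDerivAt.const_mul (c k))
  rw [derivZ_apply, h.fderiv, FunLike.coe_sum, Finset.sum_apply]
  refine Finset.sum_congr rfl fun k _ => ?_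
  rw [FunLike.coe_smul, Pi.smul_apply, derivZ_apply, smul_eq_mul]

/-- `∂_Z (F²) = 2 F ∂_Z F`. [folklore] -/
private theorem derivZ_sq {F : ℝ × ℝ → ℝ} {Y : ℝ × ℝ} (hF : DifferentiableAt ℝ F Y) :
    derivZ (fun q => F q ^ 2) Y = 2 * F Y * derivZ F Y := by
  have h : HasFDerivAt (fun q => F q * F q) (F Y • fderiv ℝ F Y + F Y • fderiv ℝ F Y) Y :=
    hF.hasFDerivAt.mul hF.hasFDerivAt
  have e : (fun q => F q ^ 2) = fun q => F q * F q := funext fun q => sq (F q)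
  rw [e, derivZ_apply, h.fderiv, derivZ_apply]
  simp only [FunLike.coe_add, Pi.add_apply, FunLike.coe_smul, Pi.smul_apply,
    smul_eq_mul]
  ring

/-- Linear recombination of finite sums (two families). [folklore] -/
private theorem sum_shape2 (N : ℕ) (f g : ℕ → ℝ) (a b : ℝ) :
    ∑ k ∈ Finset.range N, (a * f k + b * g k) =
      a * (∑ k ∈ Finset.range N, f k) + b * (∑ k ∈ Finset.range N, g k) := by
  rw [Finset.sum_add_distrib, Finset.mul_sum, Finset.mul_sum]

/-- Linear recombination of finite sums (four families). [folklore] -/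
private theorem sum_shape4 (N : ℕ) (f g h w : ℕ → ℝ) (a b c d : ℝ) :
    ∑ k ∈ Finset.range N, (a * f k + b * g k + c * h k + d * w k) =
      a * (∑ k ∈ Finset.range N, f k) + b * (∑ k ∈ Finset.range N, g k) +
        c * (∑ k ∈ Finset.range N, h k) + d * (∑ k ∈ Finset.range N, w k) := by
  rw [Finset.sum_add_distrib, Finset.sum_add_distrib, Finset.sum_add_distrib, Finset.mul_sum,
    Finset.mul_sum, Finset.mul_sum, Finset.mul_sum]

/-- The open left half-plane is open. [folklore] -/
private theorem isOpen_ltHalfPlane : IsOpen {Y : ℝ × ℝ | Y.1 < 0} :=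
  isOpen_lt continuous_fst continuous_const

end Series2

section Window

open LuoHouAnsatz

variable {S : Set ℝ} {T γ : ℝ} {u₁ ω₁ ψ₁ : ℝ → ℝ × ℝ → ℝ} {U Ω Ψ : ℕ → ℝ × ℝ → ℝ}
  {O : Set (ℝ × ℝ)} {N : ℕ}

/-- **All orders of Chae–Tsai's substituted equations for the generalized ansatz, at an
admissible time of the SHRINKING WINDOW `𝒲_{δ(t)}`.** Setting of Chae–Tsai's second region
`𝒲 = {1 − δ(t) < r < 1, |z| < δ(t), T₀ < t < T}` with `δ` non-increasing: if the finite-order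
ansatz (11k)–(13k) and the `(u₁, ω₁, ψ₁)` Euler equations hold on `𝒲`, the solution is classical
in time there, and at a time `t ∈ (T₀, T)` the point `q = (1 + sR, sZ)`, `s = (T−t)^γ`, lies in
the window with `s|R| < 1`, then the three generating identities of
`series_substitution_at_scale` hold at `Y = (R, Z)` with this `s` (the window at time `t`
contains `q` at all earlier times, so the time derivative is read on `𝓝[≤] t`, as in
`LuoHouAnsatz.substitution_at_window`).
[cite: ChaeTsai2015, §3 Thm. 2 with (11k)–(13k) on the region (thm2region2)–(thm2region2b) (arXiv p. 4–5)] -/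
theorem series_substitution_at_window {T₀ : ℝ} {δf : ℝ → ℝ} (hS : Ioo T₀ T ⊆ S)
    (hanti : AntitoneOn δf (Ioo T₀ T))
    (hO : IsOpen O) (hHO : {Y : ℝ × ℝ | Y.1 ≤ 0} ⊆ O)
    (hU : ∀ k, ContDiffOn ℝ 1 (U k) O) (hΩ : ∀ k, ContDiffOn ℝ 1 (Ω k) O)
    (hΨ : ∀ k, ContDiffOn ℝ 2 (Ψ k) O)
    (hE : ∀ t ∈ Ioo T₀ T, ∀ q : ℝ × ℝ, 1 - δf t < q.1 → q.1 < 1 → |q.2| < δf t →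
      GeneralizedAxisymNS S 3 0 u₁ ω₁ ψ₁ t q)
    (hu : ∀ t ∈ Ioo T₀ T, ∀ q : ℝ × ℝ, 1 - δf t < q.1 → q.1 < 1 → |q.2| < δf t →
      u₁ t q = (T - t) ^ (-1 + γ / 2) * ∑ k ∈ Finset.range N,
        ((T - t) ^ γ) ^ k * U k ((q.1 - 1) / (T - t) ^ γ, q.2 / (T - t) ^ γ))
    (hω : ∀ t ∈ Ioo T₀ T, ∀ q : ℝ × ℝ, 1 - δf t < q.1 → q.1 < 1 → |q.2| < δf t →
      ω₁ t q = (T - t)⁻¹ * ∑ k ∈ Finset.range N,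
        ((T - t) ^ γ) ^ k * Ω k ((q.1 - 1) / (T - t) ^ γ, q.2 / (T - t) ^ γ))
    (hψ : ∀ t ∈ Ioo T₀ T, ∀ q : ℝ × ℝ, 1 - δf t < q.1 → q.1 < 1 → |q.2| < δf t →
      ψ₁ t q = (T - t) ^ (-1 + 2 * γ) * ∑ k ∈ Finset.range N,
        ((T - t) ^ γ) ^ k * Ψ k ((q.1 - 1) / (T - t) ^ γ, q.2 / (T - t) ^ γ))
    (hdiff : ∀ t ∈ Ioo T₀ T, ∀ q : ℝ × ℝ, 1 - δf t < q.1 → q.1 < 1 → |q.2| < δf t →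
      DifferentiableAt ℝ (fun t' => u₁ t' q) t ∧ DifferentiableAt ℝ (fun t' => ω₁ t' q) t)
    {Y : ℝ × ℝ} (hY1 : Y.1 < 0) {t : ℝ} (ht : t ∈ Ioo T₀ T) {s : ℝ} (hτγ : (T - t) ^ γ = s)
    (hsY1 : s * |Y.1| < min (δf t) 1) (hsY2 : s * |Y.2| < δf t) :
    ((∑ k ∈ Finset.range N, s ^ k * ((1 - γ / 2 - k * γ) * U k Y)) +
        γ * (Y.1 * (∑ k ∈ Finset.range N, s ^ k * derivR (U k) Y) +
          Y.2 * (∑ k ∈ Finset.range N, s ^ k * derivZ (U k) Y)) +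
        (-(∑ k ∈ Finset.range N, s ^ k * derivZ (Ψ k) Y) *
            (∑ k ∈ Finset.range N, s ^ k * derivR (U k) Y) +
          (∑ k ∈ Finset.range N, s ^ k * derivR (Ψ k) Y) *
            (∑ k ∈ Finset.range N, s ^ k * derivZ (U k) Y)) +
      s * (Y.1 * (-(∑ k ∈ Finset.range N, s ^ k * derivZ (Ψ k) Y) *
            (∑ k ∈ Finset.range N, s ^ k * derivR (U k) Y) +
          (∑ k ∈ Finset.range N, s ^ k * derivR (Ψ k) Y) *
            (∑ k ∈ Finset.range N, s ^ k * derivZ (U k) Y)) +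
        2 * (∑ k ∈ Finset.range N, s ^ k * Ψ k Y) *
          (∑ k ∈ Finset.range N, s ^ k * derivZ (U k) Y) -
        2 * (∑ k ∈ Finset.range N, s ^ k * U k Y) *
          (∑ k ∈ Finset.range N, s ^ k * derivZ (Ψ k) Y)) = 0) ∧
    ((∑ k ∈ Finset.range N, s ^ k * ((1 - k * γ) * Ω k Y)) +
        γ * (Y.1 * (∑ k ∈ Finset.range N, s ^ k * derivR (Ω k) Y) +
          Y.2 * (∑ k ∈ Finset.range N, s ^ k * derivZ (Ω k) Y)) +
        (-(∑ k ∈ Finset.range N, s ^ k * derivZ (Ψ k) Y) *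
            (∑ k ∈ Finset.range N, s ^ k * derivR (Ω k) Y) +
          (∑ k ∈ Finset.range N, s ^ k * derivR (Ψ k) Y) *
            (∑ k ∈ Finset.range N, s ^ k * derivZ (Ω k) Y)) -
        2 * (∑ k ∈ Finset.range N, s ^ k * U k Y) *
          (∑ k ∈ Finset.range N, s ^ k * derivZ (U k) Y) +
      s * (Y.1 * (-(∑ k ∈ Finset.range N, s ^ k * derivZ (Ψ k) Y) *
            (∑ k ∈ Finset.range N, s ^ k * derivR (Ω k) Y) +
          (∑ k ∈ Finset.range N, s ^ k * derivR (Ψ k) Y) *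
            (∑ k ∈ Finset.range N, s ^ k * derivZ (Ω k) Y)) +
        2 * (∑ k ∈ Finset.range N, s ^ k * Ψ k Y) *
          (∑ k ∈ Finset.range N, s ^ k * derivZ (Ω k) Y)) = 0) ∧
    (-(∑ k ∈ Finset.range N, s ^ k * (derivR (derivR (Ψ k)) Y + derivZ (derivZ (Ψ k)) Y)) -
        (∑ k ∈ Finset.range N, s ^ k * Ω k Y) +
      s * (-(Y.1 * (∑ k ∈ Finset.range N, s ^ k *
          (derivR (derivR (Ψ k)) Y + derivZ (derivZ (Ψ k)) Y))) -
        3 * (∑ k ∈ Finset.range N, s ^ k * derivR (Ψ k) Y) -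
        Y.1 * (∑ k ∈ Finset.range N, s ^ k * Ω k Y)) = 0) := by
  -- the partial sums as profiles on the open left half-plane
  have hlt : {Y : ℝ × ℝ | Y.1 < 0} ⊆ O := fun Y' hY' => hHO (show Y'.1 ≤ 0 from le_of_lt hY')
  set Us : ℝ × ℝ → ℝ := fun q => ∑ k ∈ Finset.range N, s ^ k * U k q with hUs
  set Ωs : ℝ × ℝ → ℝ := fun q => ∑ k ∈ Finset.range N, s ^ k * Ω k q with hΩs
  set Ψs : ℝ × ℝ → ℝ := fun q => ∑ k ∈ Finset.range N, s ^ k * Ψ k q with hΨs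
  have hUs1 : ContDiffOn ℝ 1 Us {Y : ℝ × ℝ | Y.1 < 0} :=
    ContDiffOn.sum fun k _ => ((contDiffOn_const).mul ((hU k).mono hlt))
  have hΩs1 : ContDiffOn ℝ 1 Ωs {Y : ℝ × ℝ | Y.1 < 0} :=
    ContDiffOn.sum fun k _ => ((contDiffOn_const).mul ((hΩ k).mono hlt))
  have hΨs2 : ContDiffOn ℝ 2 Ψs {Y : ℝ × ℝ | Y.1 < 0} :=
    ContDiffOn.sum fun k _ => ((contDiffOn_const).mul ((hΨ k).mono hlt))
  -- the point `q = (1 + sR, sZ)` at the given time `t`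
  have htT : t < T := ht.2
  have hs : 0 < s := by rw [← hτγ]; exact Real.rpow_pos_of_pos (sub_pos.2 htT) _
  set q : ℝ × ℝ := (1 + s * Y.1, s * Y.2) with hqdef
  have hY1abs : |Y.1| = -Y.1 := abs_of_neg hY1
  have hq1lt : q.1 < 1 := by
    show 1 + s * Y.1 < 1
    nlinarith
  have hq1gt : 1 - δf t < q.1 := by
    show 1 - δf t < 1 + s * Y.1
    have := lt_of_lt_of_le hsY1 (min_le_left _ _)
    rw [hY1abs] at this; linarith
  have hq1pos : 0 < q.1 := by
    show 0 < 1 + s * Y.1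
    have := lt_of_lt_of_le hsY1 (min_le_right _ _)
    rw [hY1abs] at this; linarith
  have hq2 : |q.2| < δf t := by
    show |s * Y.2| < δf t
    rwa [abs_mul, abs_of_pos hs]
  have hYq : Y = ((q.1 - 1) / (T - t) ^ γ, q.2 / (T - t) ^ γ) := by
    rw [hτγ]
    ext
    · show Y.1 = (1 + s * Y.1 - 1) / s
      field_simp; ring
    · show Y.2 = s * Y.2 / s
      field_simp
  -- the window's time slice is a neighbourhood of `q`
  have hreg : ∀ᶠ q' : ℝ × ℝ in 𝓝 q, 1 - δf t < q'.1 ∧ q'.1 < 1 ∧ |q'.2| < δf t := by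
    have ho : IsOpen {q' : ℝ × ℝ | 1 - δf t < q'.1 ∧ q'.1 < 1 ∧ |q'.2| < δf t} :=
      (isOpen_lt continuous_const continuous_fst).inter
        ((isOpen_lt continuous_fst continuous_const).inter
          (isOpen_lt (continuous_abs.comp continuous_snd) continuous_const))
    exact ho.mem_nhds ⟨hq1gt, hq1lt, hq2⟩
  have hu' : u₁ t =ᶠ[𝓝 q] fun q' =>
      (T - t) ^ (-1 + γ / 2) * Us ((q'.1 - 1) / (T - t) ^ γ, q'.2 / (T - t) ^ γ) :=
    hreg.mono fun q' hq' => by rw [hu t ht q' hq'.1 hq'.2.1 hq'.2.2, hUs, hτγ]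
  have hω' : ω₁ t =ᶠ[𝓝 q] fun q' =>
      (T - t)⁻¹ * Ωs ((q'.1 - 1) / (T - t) ^ γ, q'.2 / (T - t) ^ γ) :=
    hreg.mono fun q' hq' => by rw [hω t ht q' hq'.1 hq'.2.1 hq'.2.2, hΩs, hτγ]
  have hψ' : ψ₁ t =ᶠ[𝓝 q] fun q' =>
      (T - t) ^ (-1 + 2 * γ) * Ψs ((q'.1 - 1) / (T - t) ^ γ, q'.2 / (T - t) ^ γ) :=
    hreg.mono fun q' hq' => by rw [hψ t ht q' hq'.1 hq'.2.1 hq'.2.2, hΨs, hτγ]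
  -- differentiability of the individual profiles at `Y`
  have hYO : Y ∈ O := hHO hY1.le
  have dU : ∀ k ∈ Finset.range N, DifferentiableAt ℝ (U k) Y := fun k _ =>
    differentiableAt_of_contDiffOn_open (hU k) hO one_ne_zero hYO
  have dΩ : ∀ k ∈ Finset.range N, DifferentiableAt ℝ (Ω k) Y := fun k _ =>
    differentiableAt_of_contDiffOn_open (hΩ k) hO one_ne_zero hYO
  have dΨ : ∀ k ∈ Finset.range N, DifferentiableAt ℝ (Ψ k) Y := fun k _ =>
    differentiableAt_of_contDiffOn_open (hΨ k) hO two_ne_zero hYO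
  -- first partials of the partial sums at `Y`
  have eUsR : derivR Us Y = ∑ k ∈ Finset.range N, s ^ k * derivR (U k) Y :=
    derivR_finsum (fun k => s ^ k) dU
  have eUsZ : derivZ Us Y = ∑ k ∈ Finset.range N, s ^ k * derivZ (U k) Y :=
    derivZ_finsum (fun k => s ^ k) dU
  have eΩsR : derivR Ωs Y = ∑ k ∈ Finset.range N, s ^ k * derivR (Ω k) Y :=
    derivR_finsum (fun k => s ^ k) dΩ
  have eΩsZ : derivZ Ωs Y = ∑ k ∈ Finset.range N, s ^ k * derivZ (Ω k) Y :=
    derivZ_finsum (fun k => s ^ k) dΩ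
  have eΨsR : derivR Ψs Y = ∑ k ∈ Finset.range N, s ^ k * derivR (Ψ k) Y :=
    derivR_finsum (fun k => s ^ k) dΨ
  have eΨsZ : derivZ Ψs Y = ∑ k ∈ Finset.range N, s ^ k * derivZ (Ψ k) Y :=
    derivZ_finsum (fun k => s ^ k) dΨ
  -- second partials of `Ψs` at `Y` (the first partials are sums near `Y`)
  have evΨsR : derivR Ψs =ᶠ[𝓝 Y] fun q => ∑ k ∈ Finset.range N, s ^ k * derivR (Ψ k) q := by
    filter_upwards [hO.mem_nhds hYO] with q hq
    exact derivR_finsum (fun k => s ^ k) fun k _ =>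
      differentiableAt_of_contDiffOn_open (hΨ k) hO two_ne_zero hq
  have evΨsZ : derivZ Ψs =ᶠ[𝓝 Y] fun q => ∑ k ∈ Finset.range N, s ^ k * derivZ (Ψ k) q := by
    filter_upwards [hO.mem_nhds hYO] with q hq
    exact derivZ_finsum (fun k => s ^ k) fun k _ =>
      differentiableAt_of_contDiffOn_open (hΨ k) hO two_ne_zero hq
  have eΨsRR : derivR (derivR Ψs) Y = ∑ k ∈ Finset.range N, s ^ k * derivR (derivR (Ψ k)) Y := by
    rw [derivR_congr_nhds evΨsR]
    exact derivR_finsum (fun k => s ^ k) fun k _ =>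
      differentiableAt_of_contDiffOn_open (contDiffOn_derivR_open (hΨ k) hO) hO one_ne_zero hYO
  have eΨsZZ : derivZ (derivZ Ψs) Y = ∑ k ∈ Finset.range N, s ^ k * derivZ (derivZ (Ψ k)) Y := by
    rw [derivZ_congr_nhds evΨsZ]
    exact derivZ_finsum (fun k => s ^ k) fun k _ =>
      differentiableAt_of_contDiffOn_open (contDiffOn_derivZ_open (hΨ k) hO) hO one_ne_zero hYO
  have hUsd : DifferentiableAt ℝ Us Y :=
    differentiableAt_of_contDiffOn_open hUs1 isOpen_ltHalfPlane one_ne_zero hY1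
  have eUs2Z : derivZ (fun Y' => Us Y' ^ 2) Y =
      2 * (∑ k ∈ Finset.range N, s ^ k * U k Y) * (∑ k ∈ Finset.range N, s ^ k * derivZ (U k) Y) := by
    rw [derivZ_sq hUsd, eUsZ]
  -- time derivatives of the series at `(t, q)`: earlier times of the window see `q`
  have hpast : ∀ t' ∈ Ioc T₀ t, 1 - δf t' < q.1 ∧ q.1 < 1 ∧ |q.2| < δf t' := by
    intro t' ht'
    rcases eq_or_lt_of_le ht'.2 with h | h
    · rw [h]; exact ⟨hq1gt, hq1lt, hq2⟩
    · have hmono : δf t ≤ δf t' := hanti ⟨ht'.1, by linarith⟩ ht h.le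
      exact ⟨by linarith, hq1lt, lt_of_lt_of_le hq2 hmono⟩
  have hleft : Ioc T₀ t ∈ 𝓝[≤] t := Ioc_mem_nhdsLE ht.1
  obtain ⟨hdu₁, hdω₁⟩ := hdiff t ht q hq1gt hq1lt hq2
  have hSt : S ∈ 𝓝 t := Filter.mem_of_superset (isOpen_Ioo.mem_nhds ht) hS
  have hAu := hasDerivAt_series_time (a := -1 + γ / 2) htT hYq dU
  have hAω := hasDerivAt_series_time (a := -1) htT hYq dΩ
  have hdu : timeDerivWithin S u₁ t q = (T - t) ^ (-1 + γ / 2) * (T - t)⁻¹ *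
      (((1 - γ / 2) * Us Y - γ * (∑ k ∈ Finset.range N, s ^ k * (k * U k Y))) +
        γ * (Y.1 * derivR Us Y + Y.2 * derivZ Us Y)) := by
    rw [timeDerivWithin_apply, derivWithin_of_mem_nhds hSt]
    have hev : (fun t' => u₁ t' q) =ᶠ[𝓝[≤] t] fun t' => (T - t') ^ (-1 + γ / 2) *
        ∑ k ∈ Finset.range N, ((T - t') ^ γ) ^ k *
          U k ((q.1 - 1) / (T - t') ^ γ, q.2 / (T - t') ^ γ) :=
      Filter.eventuallyEq_of_mem hleft fun t' ht' => by
        obtain ⟨h1, h2, h3⟩ := hpast t' ht'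
        exact hu t' ⟨ht'.1, lt_of_le_of_lt ht'.2 htT⟩ q h1 h2 h3
    rw [deriv_eq_of_eventuallyEq_nhdsLE hdu₁ hAu.differentiableAt hev, hAu.deriv, hτγ,
      eUsR, eUsZ, hUs]
    have key : ∑ k ∈ Finset.range N, s ^ k * (-(-1 + γ / 2 + k * γ) * U k Y +
        γ * (Y.1 * derivR (U k) Y + Y.2 * derivZ (U k) Y)) =
        (1 - γ / 2) * (∑ k ∈ Finset.range N, s ^ k * U k Y) +
        (-γ) * (∑ k ∈ Finset.range N, s ^ k * (k * U k Y)) +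
        γ * Y.1 * (∑ k ∈ Finset.range N, s ^ k * derivR (U k) Y) +
        γ * Y.2 * (∑ k ∈ Finset.range N, s ^ k * derivZ (U k) Y) := by
      rw [← sum_shape4]
      exact Finset.sum_congr rfl fun k _ => by ring
    simp only
    rw [key]; ring
  have hdω : timeDerivWithin S ω₁ t q = (T - t)⁻¹ * (T - t)⁻¹ *
      ((Ωs Y - γ * (∑ k ∈ Finset.range N, s ^ k * (k * Ω k Y))) +
        γ * (Y.1 * derivR Ωs Y + Y.2 * derivZ Ωs Y)) := by
    rw [timeDerivWithin_apply, derivWithin_of_mem_nhds hSt]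
    have hev : (fun t' => ω₁ t' q) =ᶠ[𝓝[≤] t] fun t' => (T - t') ^ (-1 : ℝ) *
        ∑ k ∈ Finset.range N, ((T - t') ^ γ) ^ k *
          Ω k ((q.1 - 1) / (T - t') ^ γ, q.2 / (T - t') ^ γ) :=
      Filter.eventuallyEq_of_mem hleft fun t' ht' => by
        obtain ⟨h1, h2, h3⟩ := hpast t' ht'
        rw [hω t' ⟨ht'.1, lt_of_le_of_lt ht'.2 htT⟩ q h1 h2 h3, Real.rpow_neg_one]
    rw [deriv_eq_of_eventuallyEq_nhdsLE hdω₁ hAω.differentiableAt hev, hAω.deriv,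
      Real.rpow_neg_one, hτγ, eΩsR, eΩsZ, hΩs]
    have key : ∑ k ∈ Finset.range N, s ^ k * (-(-1 + k * γ) * Ω k Y +
        γ * (Y.1 * derivR (Ω k) Y + Y.2 * derivZ (Ω k) Y)) =
        (1 : ℝ) * (∑ k ∈ Finset.range N, s ^ k * Ω k Y) +
        (-γ) * (∑ k ∈ Finset.range N, s ^ k * (k * Ω k Y)) +
        γ * Y.1 * (∑ k ∈ Finset.range N, s ^ k * derivR (Ω k) Y) +
        γ * Y.2 * (∑ k ∈ Finset.range N, s ^ k * derivZ (Ω k) Y) := by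
      rw [← sum_shape4]
      exact Finset.sum_congr rfl fun k _ => by ring
    simp only
    rw [key]; ring
  have h := substitution_corr (∑ k ∈ Finset.range N, s ^ k * (k * U k Y))
    (∑ k ∈ Finset.range N, s ^ k * (k * Ω k Y)) htT hq1pos hYq hY1 hUs1 hΩs1 hΨs2
    (hE t ht q hq1gt hq1lt hq2) hu' hω' hψ' hdu hdω
  rw [hτγ, eUsR, eUsZ, eΩsR, eΩsZ, eΨsR, eΨsZ, eΨsRR, eΨsZZ, eUs2Z] at h
  simp only [hUs, hΩs, hΨs] at h
  obtain ⟨h1, h2, h3⟩ := h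
  have e2 : ∑ k ∈ Finset.range N, s ^ k * ((1 - γ / 2 - k * γ) * U k Y) =
      (1 - γ / 2) * (∑ k ∈ Finset.range N, s ^ k * U k Y) +
        (-γ) * (∑ k ∈ Finset.range N, s ^ k * (k * U k Y)) := by
    rw [← sum_shape2]
    exact Finset.sum_congr rfl fun k _ => by ring
  have e3 : ∑ k ∈ Finset.range N, s ^ k * ((1 - k * γ) * Ω k Y) =
      (1 : ℝ) * (∑ k ∈ Finset.range N, s ^ k * Ω k Y) +
        (-γ) * (∑ k ∈ Finset.range N, s ^ k * (k * Ω k Y)) := by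
    rw [← sum_shape2]
    exact Finset.sum_congr rfl fun k _ => by ring
  have e4 : ∑ k ∈ Finset.range N, s ^ k * (derivR (derivR (Ψ k)) Y + derivZ (derivZ (Ψ k)) Y) =
      (1 : ℝ) * (∑ k ∈ Finset.range N, s ^ k * derivR (derivR (Ψ k)) Y) +
        1 * (∑ k ∈ Finset.range N, s ^ k * derivZ (derivZ (Ψ k)) Y) := by
    rw [← sum_shape2]
    exact Finset.sum_congr rfl fun k _ => by ring
  refine ⟨?_, ?_, ?_⟩
  · linear_combination h1 + e2
  · linear_combination h2 + e3
  · linear_combination h3 - (1 + s * Y.1) * e4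

end Window

/-! ### The order induction with abstract scale supply, and Theorem 2 on the window -/

section MainW

open LuoHouAnsatz

variable {S : Set ℝ} {T γ : ℝ} {u₁ ω₁ ψ₁ : ℝ → ℝ × ℝ → ℝ} {U Ω Ψ : ℕ → ℝ × ℝ → ℝ}
  {O : Set (ℝ × ℝ)} {N : ℕ}

/-- The zero profile has vanishing partials of all orders used here. [folklore] -/
private theorem derivs_of_eq_zero {G : ℝ × ℝ → ℝ} (hG : G = 0) (Y : ℝ × ℝ) :
    G Y = 0 ∧ derivR G Y = 0 ∧ derivZ G Y = 0 ∧
      derivR (derivR G) Y = 0 ∧ derivZ (derivZ G) Y = 0 := by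
  have e : G = fun _ => (0 : ℝ) := hG
  subst e
  simp [derivR_const, derivZ_const]

/-- **The order induction of Chae–Tsai's Theorem 2, with the scale supply abstracted.** If the
finite-order profiles `U_k, Ω_k ∈ C¹`, `Ψ_k ∈ C²` (on an open neighbourhood of `𝒟̄ = {R ≤ 0}`,
zero from order `N` on) satisfy, at every point of the open half-plane, the three generating
identities of `series_substitution_at_scale` for all scales `s` of a nonempty interval `(0, s₀)`
(`s₀` may depend on the point), decay as in (UOPsi-infty), satisfy the wall condition (Psi-BC)
and — only at `γ = 2` — the integrability (3.10) for `U₀`, then every `U_k`, `Ω_k` vanishes on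
`𝒟̄` and every `Ψ_k` is constant there. This is the induction of
`chaeTsai2015_seriesAnsatz_trivial` / `…_of_integralDecay` (Engines A, A′, B of p561956 and
Engine C of p566363 by name), written once for both of print's regions: the cone `𝒞_{δ,T}`
supplies the interval of scales by `series_substitution_at_scale`, the window `𝒲_{δ(t)}` by
`series_substitution_at_window` and polynomial rigidity in the scale.
[cite: ChaeTsai2015, §3, proof of Thm. 2 (arXiv p. 5–6)] -/
theorem profiles_trivial_of_identities (hγ : 0 < γ)
    (hO : IsOpen O) (hHO : {Y : ℝ × ℝ | Y.1 ≤ 0} ⊆ O)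
    (hU : ∀ k, ContDiffOn ℝ 1 (U k) O) (hΩ : ∀ k, ContDiffOn ℝ 1 (Ω k) O)
    (hΨ : ∀ k, ContDiffOn ℝ 2 (Ψ k) O)
    (hN : ∀ k, N ≤ k → U k = 0 ∧ Ω k = 0 ∧ Ψ k = 0)
    (hid : ∀ Y : ℝ × ℝ, Y.1 < 0 → ∃ s₀ : ℝ, 0 < s₀ ∧ ∀ s ∈ Ioo 0 s₀,
      ((∑ k ∈ Finset.range N, s ^ k * ((1 - γ / 2 - k * γ) * U k Y)) +
        γ * (Y.1 * (∑ k ∈ Finset.range N, s ^ k * derivR (U k) Y) +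
          Y.2 * (∑ k ∈ Finset.range N, s ^ k * derivZ (U k) Y)) +
        (-(∑ k ∈ Finset.range N, s ^ k * derivZ (Ψ k) Y) *
            (∑ k ∈ Finset.range N, s ^ k * derivR (U k) Y) +
          (∑ k ∈ Finset.range N, s ^ k * derivR (Ψ k) Y) *
            (∑ k ∈ Finset.range N, s ^ k * derivZ (U k) Y)) +
      s * (Y.1 * (-(∑ k ∈ Finset.range N, s ^ k * derivZ (Ψ k) Y) *
            (∑ k ∈ Finset.range N, s ^ k * derivR (U k) Y) +
          (∑ k ∈ Finset.range N, s ^ k * derivR (Ψ k) Y) *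
            (∑ k ∈ Finset.range N, s ^ k * derivZ (U k) Y)) +
        2 * (∑ k ∈ Finset.range N, s ^ k * Ψ k Y) *
          (∑ k ∈ Finset.range N, s ^ k * derivZ (U k) Y) -
        2 * (∑ k ∈ Finset.range N, s ^ k * U k Y) *
          (∑ k ∈ Finset.range N, s ^ k * derivZ (Ψ k) Y)) = 0) ∧
      ((∑ k ∈ Finset.range N, s ^ k * ((1 - k * γ) * Ω k Y)) +
        γ * (Y.1 * (∑ k ∈ Finset.range N, s ^ k * derivR (Ω k) Y) +
          Y.2 * (∑ k ∈ Finset.range N, s ^ k * derivZ (Ω k) Y)) +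
        (-(∑ k ∈ Finset.range N, s ^ k * derivZ (Ψ k) Y) *
            (∑ k ∈ Finset.range N, s ^ k * derivR (Ω k) Y) +
          (∑ k ∈ Finset.range N, s ^ k * derivR (Ψ k) Y) *
            (∑ k ∈ Finset.range N, s ^ k * derivZ (Ω k) Y)) -
        2 * (∑ k ∈ Finset.range N, s ^ k * U k Y) *
          (∑ k ∈ Finset.range N, s ^ k * derivZ (U k) Y) +
      s * (Y.1 * (-(∑ k ∈ Finset.range N, s ^ k * derivZ (Ψ k) Y) *
            (∑ k ∈ Finset.range N, s ^ k * derivR (Ω k) Y) +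
          (∑ k ∈ Finset.range N, s ^ k * derivR (Ψ k) Y) *
            (∑ k ∈ Finset.range N, s ^ k * derivZ (Ω k) Y)) +
        2 * (∑ k ∈ Finset.range N, s ^ k * Ψ k Y) *
          (∑ k ∈ Finset.range N, s ^ k * derivZ (Ω k) Y)) = 0) ∧
      (-(∑ k ∈ Finset.range N, s ^ k * (derivR (derivR (Ψ k)) Y + derivZ (derivZ (Ψ k)) Y)) -
        (∑ k ∈ Finset.range N, s ^ k * Ω k Y) +
      s * (-(Y.1 * (∑ k ∈ Finset.range N, s ^ k *
          (derivR (derivR (Ψ k)) Y + derivZ (derivZ (Ψ k)) Y))) -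
        3 * (∑ k ∈ Finset.range N, s ^ k * derivR (Ψ k) Y) -
        Y.1 * (∑ k ∈ Finset.range N, s ^ k * Ω k Y)) = 0))
    (hdecay : ∀ k, ∀ ε : ℝ, 0 < ε → ∃ M : ℝ, ∀ Y : ℝ × ℝ, Y.1 ≤ 0 → M ≤ ‖Y‖ →
      |U k Y| + |Ω k Y| < ε)
    (hgrad : ∀ k, ∀ ε : ℝ, 0 < ε → ∃ M : ℝ, ∀ Y : ℝ × ℝ, Y.1 ≤ 0 → M ≤ ‖Y‖ →
      |derivR (Ψ k) Y| + |derivZ (Ψ k) Y| ≤ ε * ‖Y‖)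
    (hwall : ∀ k (Z : ℝ), derivZ (Ψ k) (0, Z) = 0)
    (h310 : γ = 2 → ∃ p : ℕ, Even p ∧ Tendsto (fun ρ : ℝ =>
      ∫ Y in {Y : ℝ × ℝ | Y.1 ≤ 0 ∧ ρ < ‖Y‖ ∧ ‖Y‖ < 2 * ρ}, U 0 Y ^ p) atTop (𝓝 0)) :
    ∀ k, ∃ b : ℝ, ∀ Y : ℝ × ℝ, Y.1 ≤ 0 →
      U k Y = 0 ∧ Ω k Y = 0 ∧ Ψ k Y = b ∧ derivR (Ψ k) Y = 0 ∧ derivZ (Ψ k) Y = 0 := by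
  -- profiles beyond the order bound
  have zU : ∀ l, N ≤ l → ∀ Y : ℝ × ℝ, U l Y = 0 ∧ derivR (U l) Y = 0 ∧ derivZ (U l) Y = 0 :=
    fun l hl Y => let h := derivs_of_eq_zero (hN l hl).1 Y; ⟨h.1, h.2.1, h.2.2.1⟩
  have zΩ : ∀ l, N ≤ l → ∀ Y : ℝ × ℝ, Ω l Y = 0 ∧ derivR (Ω l) Y = 0 ∧ derivZ (Ω l) Y = 0 :=
    fun l hl Y => let h := derivs_of_eq_zero (hN l hl).2.1 Y; ⟨h.1, h.2.1, h.2.2.1⟩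
  have zΨ : ∀ l, N ≤ l → ∀ Y : ℝ × ℝ, Ψ l Y = 0 ∧ derivR (Ψ l) Y = 0 ∧ derivZ (Ψ l) Y = 0 :=
    fun l hl Y => let h := derivs_of_eq_zero (hN l hl).2.2 Y; ⟨h.1, h.2.1, h.2.2.1⟩
  have zΨ2 : ∀ l, N ≤ l → ∀ Y : ℝ × ℝ, derivR (Ψ l) Y = 0 ∧
      derivR (derivR (Ψ l)) Y + derivZ (derivZ (Ψ l)) Y = 0 :=
    fun l hl Y => let h := derivs_of_eq_zero (hN l hl).2.2 Y; ⟨h.2.1, by rw [h.2.2.2.1, h.2.2.2.2, add_zero]⟩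
  -- decay of the individual families
  have decU : ∀ k, ∀ ε : ℝ, 0 < ε → ∃ M : ℝ, ∀ Y : ℝ × ℝ, Y.1 ≤ 0 → M ≤ ‖Y‖ → |U k Y| < ε := by
    intro k ε hε
    obtain ⟨M, hM⟩ := hdecay k ε hε
    exact ⟨M, fun Y hY hM' => by have := hM Y hY hM'; linarith [abs_nonneg (Ω k Y)]⟩
  have decΩ : ∀ k, ∀ ε : ℝ, 0 < ε → ∃ M : ℝ, ∀ Y : ℝ × ℝ, Y.1 ≤ 0 → M ≤ ‖Y‖ → |Ω k Y| < ε := by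
    intro k ε hε
    obtain ⟨M, hM⟩ := hdecay k ε hε
    exact ⟨M, fun Y hY hM' => by have := hM Y hY hM'; linarith [abs_nonneg (U k Y)]⟩
  -- the leading stream field `W = ∇⊥Ψ₀` of the maximum principle
  have hW₁ : ContinuousOn (fun Y => -derivZ (Ψ 0) Y) O :=
    (continuousOn_derivZ_open ((hΨ 0).of_le one_le_two) hO).neg
  have hW₂ : ContinuousOn (derivR (Ψ 0)) O := continuousOn_derivR_open ((hΨ 0).of_le one_le_two) hO
  have hW₁wall : ∀ Z : ℝ, (fun Y => -derivZ (Ψ 0) Y) (0, Z) = 0 := fun Z => by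
    simp only [hwall 0 Z, neg_zero]
  -- THE INDUCTION ON THE ORDER
  have main : ∀ k : ℕ, ∀ l, l < k →
      (∀ Y : ℝ × ℝ, Y.1 ≤ 0 → U l Y = 0 ∧ Ω l Y = 0) ∧
      ∃ a b : ℝ, (∀ Y : ℝ × ℝ, Y.1 ≤ 0 →
        Ψ l Y = a * Y.1 + b ∧ derivR (Ψ l) Y = a ∧ derivZ (Ψ l) Y = 0) ∧ (l + 1 < k → a = 0) := by
    intro k
    induction k with
    | zero => intro l hl; exact absurd hl (Nat.not_lt_zero l)
    | succ k ih =>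
      -- data below order `k`
      have hUl : ∀ l, l < k → ∀ Y : ℝ × ℝ, Y.1 ≤ 0 → U l Y = 0 :=
        fun l hl Y hY => ((ih l hl).1 Y hY).1
      have hΩl : ∀ l, l < k → ∀ Y : ℝ × ℝ, Y.1 ≤ 0 → Ω l Y = 0 :=
        fun l hl Y hY => ((ih l hl).1 Y hY).2
      have vU : ∀ l, l < k → ∀ Y : ℝ × ℝ, Y.1 ≤ 0 →
          U l Y = 0 ∧ derivR (U l) Y = 0 ∧ derivZ (U l) Y = 0 := fun l hl Y hY =>
        ⟨hUl l hl Y hY, derivR_derivZ_eq_zero_of_eq_zero hO hHO (hU l) (hUl l hl) hY⟩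
      have vΩ : ∀ l, l < k → ∀ Y : ℝ × ℝ, Y.1 ≤ 0 →
          Ω l Y = 0 ∧ derivR (Ω l) Y = 0 ∧ derivZ (Ω l) Y = 0 := fun l hl Y hY =>
        ⟨hΩl l hl Y hY, derivR_derivZ_eq_zero_of_eq_zero hO hHO (hΩ l) (hΩl l hl) hY⟩
      -- at a resonant order `k ≥ 1` the leading stream profile is affine
      have hres : 0 < k →
          ∃ a₀ : ℝ, ∀ Y : ℝ × ℝ, Y.1 ≤ 0 → derivR (Ψ 0) Y = a₀ ∧ derivZ (Ψ 0) Y = 0 := by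
        intro hk
        obtain ⟨_, a₀, b₀, hΨ0, _⟩ := ih 0 hk
        exact ⟨a₀, fun Y hY => ⟨(hΨ0 Y hY).2.1, (hΨ0 Y hY).2.2⟩⟩
      -- from an affine leading stream profile, the transport field is radial from a wall point
      have hray : ∀ (G : ℝ × ℝ → ℝ) (a₀ : ℝ),
          (∀ Y : ℝ × ℝ, Y.1 ≤ 0 → derivR (Ψ 0) Y = a₀ ∧ derivZ (Ψ 0) Y = 0) →
          (∀ Y : ℝ × ℝ, Y.1 < 0 → (0 : ℝ) * G Y + γ * (Y.1 * derivR G Y + Y.2 * derivZ G Y) +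
            (-derivZ (Ψ 0) Y * derivR G Y + derivR (Ψ 0) Y * derivZ G Y) = 0) →
          ∀ Y : ℝ × ℝ, Y.1 < 0 → Y.1 * derivR G Y + (Y.2 - (-a₀ / γ)) * derivZ G Y = 0 := by
        intro G a₀ hΨ0 heq Y hY
        have e := heq Y hY
        rw [(hΨ0 Y hY.le).1, (hΨ0 Y hY.le).2] at e
        have h' : γ * (Y.1 * derivR G Y + Y.2 * derivZ G Y) + a₀ * derivZ G Y = 0 := by
          linear_combination e
        have : Y.1 * derivR G Y + (Y.2 - (-a₀ / γ)) * derivZ G Y =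
            γ⁻¹ * (γ * (Y.1 * derivR G Y + Y.2 * derivZ G Y) + a₀ * derivZ G Y) := by
          field_simp
          ring
        rw [this, h', mul_zero]
      -- STEP 1: `U_k ≡ 0`
      have hUk : ∀ Y : ℝ × ℝ, Y.1 ≤ 0 → U k Y = 0 := by
        have hred : ∀ Y : ℝ × ℝ, Y.1 < 0 → (1 - γ / 2 - k * γ) * U k Y +
            γ * (Y.1 * derivR (U k) Y + Y.2 * derivZ (U k) Y) +
            (-derivZ (Ψ 0) Y * derivR (U k) Y + derivR (Ψ 0) Y * derivZ (U k) Y) = 0 := by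
          intro Y hY
          obtain ⟨s₀, hs₀, hsc⟩ := hid Y hY
          exact order_swirl hs₀ (fun s hs => (hsc s hs).1) k (fun l hl => zU l hl Y)
            (fun l hl => zΨ l hl Y) (fun l hl => vU l hl Y hY.le)
        by_cases hc : 1 - γ / 2 - k * γ = 0
        · rcases Nat.eq_zero_or_pos k with hk0 | hkpos
          · -- THE RESONANT ORDER `0` AT `γ = 2`: Engine C (print's cut-off argument)
            subst hk0
            have hγ2 : γ = 2 := by push_cast at hc; linarith
            obtain ⟨p, hp, h310⟩ := h310 hγ2
            refine eq_zero_of_transport_wall_cutoff hO hHO hγ (hU 0) (hΨ 0) (hwall 0)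
              (fun Y hY => ?_) (hgrad 0) hp h310
            have e := hred Y hY
            rw [hc, zero_mul, zero_add] at e
            exact e
          · obtain ⟨a₀, hΨ0⟩ := hres hkpos
            refine eq_zero_of_rayTransport hO hHO (hU k) (hray (U k) a₀ hΨ0 fun Y hY => ?_)
              (decU k)
            have e := hred Y hY
            rw [hc] at e
            exact e
        · exact eq_zero_of_transport_wall_maxPrinciple hO hHO hc (hU k) hW₁ hW₂ hW₁wall hred (decU k)
      have vUk : ∀ l, l ≤ k → ∀ Y : ℝ × ℝ, Y.1 ≤ 0 →
          U l Y = 0 ∧ derivR (U l) Y = 0 ∧ derivZ (U l) Y = 0 := by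
        intro l hl Y hY
        rcases hl.lt_or_eq with hlt | heq
        · exact vU l hlt Y hY
        · rw [heq]
          exact ⟨hUk Y hY, derivR_derivZ_eq_zero_of_eq_zero hO hHO (hU k) hUk hY⟩
      -- STEP 2: `Ω_k ≡ 0`
      have hΩk : ∀ Y : ℝ × ℝ, Y.1 ≤ 0 → Ω k Y = 0 := by
        have hred : ∀ Y : ℝ × ℝ, Y.1 < 0 → (1 - k * γ) * Ω k Y +
            γ * (Y.1 * derivR (Ω k) Y + Y.2 * derivZ (Ω k) Y) +
            (-derivZ (Ψ 0) Y * derivR (Ω k) Y + derivR (Ψ 0) Y * derivZ (Ω k) Y) = 0 := by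
          intro Y hY
          obtain ⟨s₀, hs₀, hsc⟩ := hid Y hY
          exact order_vorticity hs₀ (fun s hs => (hsc s hs).2.1) k (fun l hl => zU l hl Y)
            (fun l hl => zΩ l hl Y) (fun l hl => zΨ l hl Y) (fun l hl => vUk l hl Y hY.le)
            (fun l hl => vΩ l hl Y hY.le)
        by_cases hc : 1 - k * γ = 0
        · have hkpos : 0 < k := by
            rcases Nat.eq_zero_or_pos k with h0 | h0
            · exfalso; rw [h0] at hc; push_cast at hc; linarith
            · exact h0
          obtain ⟨a₀, hΨ0⟩ := hres hkpos
          refine eq_zero_of_rayTransport hO hHO (hΩ k) (hray (Ω k) a₀ hΨ0 fun Y hY => ?_) (decΩ k)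
          have e := hred Y hY
          rw [hc] at e
          exact e
        · exact eq_zero_of_transport_wall_maxPrinciple hO hHO hc (hΩ k) hW₁ hW₂ hW₁wall hred (decΩ k)
      -- STEP 3: the stream profile `Ψ_k`: constant Laplacian `κ`, then engine B
      have hopen : IsOpen {q : ℝ × ℝ | q.1 < 0} := isOpen_lt continuous_fst continuous_const
      have hstream : ∀ Y : ℝ × ℝ, Y.1 < 0 →
          (-(derivR (derivR (Ψ 0)) Y + derivZ (derivZ (Ψ 0)) Y) - Ω 0 Y = 0) ∧
          ∀ m : ℕ, -(derivR (derivR (Ψ (m + 1))) Y + derivZ (derivZ (Ψ (m + 1))) Y) -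
            Y.1 * (derivR (derivR (Ψ m)) Y + derivZ (derivZ (Ψ m)) Y) - 3 * derivR (Ψ m) Y -
            Ω (m + 1) Y - Y.1 * Ω m Y = 0 := by
        intro Y hY
        obtain ⟨s₀, hs₀, hsc⟩ := hid Y hY
        exact order_stream hs₀ (fun s hs => (hsc s hs).2.2) (fun l hl => (zΩ l hl Y).1)
          (fun l hl => zΨ2 l hl Y)
      -- `κ` and the previous slope
      obtain ⟨κ, aprev, hκa, hprev, hpoisson⟩ : ∃ κ aprev : ℝ, κ = -3 * aprev ∧
          (∀ k', k = k' + 1 → ∀ Y : ℝ × ℝ, Y.1 ≤ 0 → derivR (Ψ k') Y = aprev) ∧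
          ∀ Y : ℝ × ℝ, Y.1 < 0 → derivR (derivR (Ψ k)) Y + derivZ (derivZ (Ψ k)) Y = κ := by
        cases k with
        | zero =>
          refine ⟨0, 0, by ring, fun k' hk' => absurd hk' (by omega), fun Y hY => ?_⟩
          have h := (hstream Y hY).1
          rw [hΩk Y hY.le] at h
          linear_combination -h
        | succ k' =>
          obtain ⟨_, a', b', hΨ', _⟩ := ih k' (Nat.lt_succ_self k')
          refine ⟨-3 * a', a', rfl, fun k'' hk'' Y hY => ?_, fun Y hY => ?_⟩
          · have : k'' = k' := by omega
            subst this
            exact (hΨ' Y hY).2.1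
          · have h := (hstream Y hY).2 k'
            -- `ΔΨ_{k'} = 0` on the open half-plane: its partials are locally constant there
            have hRR : derivR (derivR (Ψ k')) Y = 0 := by
              have hev : derivR (Ψ k') =ᶠ[𝓝 Y] fun _ => a' := by
                filter_upwards [hopen.mem_nhds hY] with q hq
                exact (hΨ' q (le_of_lt hq)).2.1
              rw [derivR_congr_nhds hev, derivR_const]
            have hZZ : derivZ (derivZ (Ψ k')) Y = 0 := by
              have hev : derivZ (Ψ k') =ᶠ[𝓝 Y] fun _ => (0 : ℝ) := by
                filter_upwards [hopen.mem_nhds hY] with q hq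
                exact (hΨ' q (le_of_lt hq)).2.2
              rw [derivZ_congr_nhds hev, derivZ_const]
            rw [hRR, hZZ, (hΨ' Y hY.le).2.1, hΩk Y hY.le, hΩl k' (Nat.lt_succ_self k') Y hY.le] at h
            linear_combination -h
      obtain ⟨hκ0, a, b, hΨk⟩ := stream_affine_of_wall_of_sublinearGradient hO hHO (hΨ k) (hwall k)
        hpoisson (hgrad k)
      have haprev : ∀ k', k = k' + 1 → aprev = 0 := by
        intro k' hk'
        have h3 : -3 * aprev = 0 := by rw [← hκa]; exact hκ0
        linarith
      -- packaging order `k + 1`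
      intro l hl
      by_cases hlk : l < k
      · obtain ⟨hUΩ, a₁, b₁, hΨ₁, himp⟩ := ih l hlk
        refine ⟨hUΩ, a₁, b₁, hΨ₁, fun hl1 => ?_⟩
        by_cases hl2 : l + 1 < k
        · exact himp hl2
        · have hkl : k = l + 1 := by omega
          have e1 := (hΨ₁ (0, 0) le_rfl).2.1
          have e2 := hprev l hkl (0, 0) le_rfl
          rw [← e1, e2]
          exact haprev l hkl
      · have hlk' : l = k := by omega
        subst hlk'
        exact ⟨fun Y hY => ⟨hUk Y hY, hΩk Y hY⟩, a, b, hΨk, fun h => absurd h (lt_irrefl _)⟩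
  -- CONSEQUENCES for the profiles
  intro k
  obtain ⟨hUΩ, a, b, hΨk, himp⟩ := main (k + 2) k (by omega)
  have ha : a = 0 := himp (by omega)
  refine ⟨b, fun Y hY => ⟨(hUΩ Y hY).1, (hUΩ Y hY).2, ?_, ?_, (hΨk Y hY).2.2⟩⟩
  · rw [(hΨk Y hY).1, ha]; ring
  · rw [(hΨk Y hY).2.1, ha]

/-- **Chae–Tsai 2015, Theorem 2 on the SHRINKING WINDOW `𝒲_{δ(t)}`, finite order, every
`γ > 0`.** Print's second region: `δ(t) > 0` non-increasing on `(T₀, T)` with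
`limsup_{t↑T} (T−t)^{−γ} δ(t) = ∞` (rendered as in `LuoHouAnsatz.profileSystem_of_window`: for
every `M` and every `t₁ < T` there is `t ∈ (t₁, T) ∩ (T₀, T)` with `M (T−t)^γ < δ(t)`; print's
`δ(t) → 0` is not needed); the finite-order ansatz (11k)–(13k) and the `(u₁, ω₁, ψ₁)` Euler
equations on `𝒲 = {1 − δ(t) < r < 1, |z| < δ(t), T₀ < t < T}`, classical in time there
(`hdiff`, used for the one-sided time derivative as in p555925); profiles `U_k, Ω_k ∈ C¹`,
`Ψ_k ∈ C²` near `𝒟̄`, zero from order `N` on, with the decay (UOPsi-infty), the wall condition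
(Psi-BC) and — only at `γ = 2` — (3.10) for `U₀`, exactly as in
`chaeTsai2015_seriesAnsatz_trivial_of_integralDecay` (whose cone binders `hδ`, `hS`, `hE`, `hu`,
`hω`, `hψ` on `𝒞_{δ,T}` are replaced by `hS`, `hanti`, `hsup`, `hE`, `hu`, `hω`, `hψ`, `hdiff` on
`𝒲`). Then every `U_k`, `Ω_k` vanishes on `𝒟̄`, every `Ψ_k` is constant there, and
`u₁ = ω₁ = 0`, `∇ψ₁ = 0` on `𝒲`. Proof: at each interior profile point the window supplies
admissible scales below every `ε > 0` (`hsup`), an infinite set on which the three generating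
identities hold (`series_substitution_at_window`); being polynomial in the scale they hold at
every scale, and `profiles_trivial_of_identities` concludes.
[cite: ChaeTsai2015, §3 Theorem 2 "in either the set 𝒞_{δ,T} … or in the set 𝒲_{δ(t)}" with (thm2region2)–(thm2region2b) (arXiv p. 4–6)] -/
theorem chaeTsai2015_seriesAnsatz_trivial_of_window {T₀ : ℝ} {δf : ℝ → ℝ} (hγ : 0 < γ)
    (hS : Ioo T₀ T ⊆ S) (hanti : AntitoneOn δf (Ioo T₀ T))
    (hsup : ∀ M t₁ : ℝ, t₁ < T → ∃ t ∈ Ioo t₁ T, T₀ < t ∧ M * (T - t) ^ γ < δf t)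
    (hO : IsOpen O) (hHO : {Y : ℝ × ℝ | Y.1 ≤ 0} ⊆ O)
    (hU : ∀ k, ContDiffOn ℝ 1 (U k) O) (hΩ : ∀ k, ContDiffOn ℝ 1 (Ω k) O)
    (hΨ : ∀ k, ContDiffOn ℝ 2 (Ψ k) O)
    (hN : ∀ k, N ≤ k → U k = 0 ∧ Ω k = 0 ∧ Ψ k = 0)
    (hE : ∀ t ∈ Ioo T₀ T, ∀ q : ℝ × ℝ, 1 - δf t < q.1 → q.1 < 1 → |q.2| < δf t →
      GeneralizedAxisymNS S 3 0 u₁ ω₁ ψ₁ t q)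
    (hu : ∀ t ∈ Ioo T₀ T, ∀ q : ℝ × ℝ, 1 - δf t < q.1 → q.1 < 1 → |q.2| < δf t →
      u₁ t q = (T - t) ^ (-1 + γ / 2) * ∑ k ∈ Finset.range N,
        ((T - t) ^ γ) ^ k * U k ((q.1 - 1) / (T - t) ^ γ, q.2 / (T - t) ^ γ))
    (hω : ∀ t ∈ Ioo T₀ T, ∀ q : ℝ × ℝ, 1 - δf t < q.1 → q.1 < 1 → |q.2| < δf t →
      ω₁ t q = (T - t)⁻¹ * ∑ k ∈ Finset.range N,
        ((T - t) ^ γ) ^ k * Ω k ((q.1 - 1) / (T - t) ^ γ, q.2 / (T - t) ^ γ))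
    (hψ : ∀ t ∈ Ioo T₀ T, ∀ q : ℝ × ℝ, 1 - δf t < q.1 → q.1 < 1 → |q.2| < δf t →
      ψ₁ t q = (T - t) ^ (-1 + 2 * γ) * ∑ k ∈ Finset.range N,
        ((T - t) ^ γ) ^ k * Ψ k ((q.1 - 1) / (T - t) ^ γ, q.2 / (T - t) ^ γ))
    (hdiff : ∀ t ∈ Ioo T₀ T, ∀ q : ℝ × ℝ, 1 - δf t < q.1 → q.1 < 1 → |q.2| < δf t →
      DifferentiableAt ℝ (fun t' => u₁ t' q) t ∧ DifferentiableAt ℝ (fun t' => ω₁ t' q) t)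
    (hdecay : ∀ k, ∀ ε : ℝ, 0 < ε → ∃ M : ℝ, ∀ Y : ℝ × ℝ, Y.1 ≤ 0 → M ≤ ‖Y‖ →
      |U k Y| + |Ω k Y| < ε)
    (hgrad : ∀ k, ∀ ε : ℝ, 0 < ε → ∃ M : ℝ, ∀ Y : ℝ × ℝ, Y.1 ≤ 0 → M ≤ ‖Y‖ →
      |derivR (Ψ k) Y| + |derivZ (Ψ k) Y| ≤ ε * ‖Y‖)
    (hwall : ∀ k (Z : ℝ), derivZ (Ψ k) (0, Z) = 0)
    (h310 : γ = 2 → ∃ p : ℕ, Even p ∧ Tendsto (fun ρ : ℝ =>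
      ∫ Y in {Y : ℝ × ℝ | Y.1 ≤ 0 ∧ ρ < ‖Y‖ ∧ ‖Y‖ < 2 * ρ}, U 0 Y ^ p) atTop (𝓝 0)) :
    (∀ k, ∃ b : ℝ, ∀ Y : ℝ × ℝ, Y.1 ≤ 0 →
      U k Y = 0 ∧ Ω k Y = 0 ∧ Ψ k Y = b ∧ derivR (Ψ k) Y = 0 ∧ derivZ (Ψ k) Y = 0) ∧
    (∀ t ∈ Ioo T₀ T, ∀ q : ℝ × ℝ, 1 - δf t < q.1 → q.1 < 1 → |q.2| < δf t →
      u₁ t q = 0 ∧ ω₁ t q = 0 ∧ derivR (ψ₁ t) q = 0 ∧ derivZ (ψ₁ t) q = 0) := by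
  -- THE PROFILES, by the order induction, once the scale supply is established
  have prof : ∀ k, ∃ b : ℝ, ∀ Y : ℝ × ℝ, Y.1 ≤ 0 →
      U k Y = 0 ∧ Ω k Y = 0 ∧ Ψ k Y = b ∧ derivR (Ψ k) Y = 0 ∧ derivZ (Ψ k) Y = 0 := by
    refine profiles_trivial_of_identities hγ hO hHO hU hΩ hΨ hN (fun Y hY1 => ?_) hdecay hgrad
      hwall h310
    -- THE SCALE SUPPLY at `Y`: admissible scales below every `ε`, hence an infinite set of
    -- scales carrying the identities (`series_substitution_at_window`), hence all scales
    -- the set of admissible scales at `Y`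
    set A : Set ℝ := {s : ℝ | ∃ t ∈ Ioo T₀ T, (T - t) ^ γ = s ∧
      s * |Y.1| < min (δf t) 1 ∧ s * |Y.2| < δf t} with hA
    have hApos : ∀ s ∈ A, 0 < s := by
      rintro s ⟨t, ht, hts, -, -⟩
      rw [← hts]; exact Real.rpow_pos_of_pos (sub_pos.2 ht.2) _
    have hAsmall : ∀ ε : ℝ, 0 < ε → ∃ s ∈ A, s < ε := by
      intro ε hε
      -- a time `t₁` after which `(T − t)^γ < min ε (1/(|R|+1))`
      set η : ℝ := min ε (1 / (|Y.1| + 1)) with hη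
      have hηpos : 0 < η := lt_min hε (by positivity)
      set t₁ : ℝ := T - η ^ γ⁻¹ with ht₁
      have ht₁T : t₁ < T := by rw [ht₁]; linarith [Real.rpow_pos_of_pos hηpos γ⁻¹]
      obtain ⟨t, ht, hT₀, hM⟩ := hsup (|Y.1| + |Y.2| + 1) t₁ ht₁T
      have hτ : 0 < T - t := sub_pos.2 ht.2
      have hsmall : (T - t) ^ γ < η := by
        have h1 : T - t < η ^ γ⁻¹ := by rw [ht₁] at ht; linarith [ht.1]
        have h2 := Real.rpow_lt_rpow hτ.le h1 hγ
        rwa [← Real.rpow_mul hηpos.le, inv_mul_cancel₀ hγ.ne', Real.rpow_one] at h2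
      have hsε : (T - t) ^ γ < ε := lt_of_lt_of_le hsmall (min_le_left _ _)
      have hspos : 0 < (T - t) ^ γ := Real.rpow_pos_of_pos hτ _
      have hs1 : (T - t) ^ γ * |Y.1| < 1 := by
        have h := lt_of_lt_of_le hsmall (min_le_right _ _)
        have h' : (T - t) ^ γ * (|Y.1| + 1) < 1 := by
          have := mul_lt_mul_of_pos_right h (by positivity : (0 : ℝ) < |Y.1| + 1)
          rwa [div_mul_cancel₀ _ (by positivity : (|Y.1| + 1 : ℝ) ≠ 0)] at this
        nlinarith [abs_nonneg Y.1]
      have hsδ1 : (T - t) ^ γ * |Y.1| < δf t := by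
        nlinarith [abs_nonneg Y.1, abs_nonneg Y.2]
      have hsδ2 : (T - t) ^ γ * |Y.2| < δf t := by
        nlinarith [abs_nonneg Y.1, abs_nonneg Y.2]
      exact ⟨(T - t) ^ γ, ⟨t, ⟨hT₀, ht.2⟩, rfl, lt_min hsδ1 hs1, hsδ2⟩, hsε⟩
    have hAinf : A.Infinite := infinite_of_forall_exists_lt_pos hApos hAsmall
    obtain ⟨P₁, hP₁⟩ := exists_poly_swirl (N := N) (U := U) (Ψ := Ψ) (γ := γ) (Y := Y)
    obtain ⟨P₂, hP₂⟩ := exists_poly_vorticity (N := N) (U := U) (Ω := Ω) (Ψ := Ψ) (γ := γ) (Y := Y)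
    obtain ⟨P₃, hP₃⟩ := exists_poly_stream (N := N) (Ω := Ω) (Ψ := Ψ) (Y := Y)
    refine ⟨1, one_pos, fun s _ => ⟨?_, ?_, ?_⟩⟩
    · rw [← hP₁]
      refine eval_eq_zero_of_infinite hAinf (fun s' hs' => ?_) s
      obtain ⟨t, ht, hts, h1, h2⟩ := hs'
      rw [hP₁]
      exact (series_substitution_at_window hS hanti hO hHO hU hΩ hΨ hE hu hω hψ hdiff hY1 ht hts
        h1 h2).1
    · rw [← hP₂]
      refine eval_eq_zero_of_infinite hAinf (fun s' hs' => ?_) s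
      obtain ⟨t, ht, hts, h1, h2⟩ := hs'
      rw [hP₂]
      exact (series_substitution_at_window hS hanti hO hHO hU hΩ hΨ hE hu hω hψ hdiff hY1 ht hts
        h1 h2).2.1
    · rw [← hP₃]
      refine eval_eq_zero_of_infinite hAinf (fun s' hs' => ?_) s
      obtain ⟨t, ht, hts, h1, h2⟩ := hs'
      rw [hP₃]
      exact (series_substitution_at_window hS hanti hO hHO hU hΩ hΨ hE hu hω hψ hdiff hY1 ht hts
        h1 h2).2.2
  refine ⟨prof, fun t ht q hq1 hq2 hq3 => ?_⟩
  -- CONSEQUENCES for the fields on the region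
  choose b hb using prof
  have hτ : 0 < T - t := sub_pos.2 ht.2
  have hsp : 0 < (T - t) ^ γ := Real.rpow_pos_of_pos hτ γ
  have hYneg : ∀ q' : ℝ × ℝ, q'.1 < 1 → ((q'.1 - 1) / (T - t) ^ γ, q'.2 / (T - t) ^ γ).1 ≤ 0 :=
    fun q' hq' => by simp only; exact div_nonpos_of_nonpos_of_nonneg (by linarith) hsp.le
  have hreg : ∀ᶠ q' : ℝ × ℝ in 𝓝 q, 1 - δf t < q'.1 ∧ q'.1 < 1 ∧ |q'.2| < δf t := by
    have ho : IsOpen {q' : ℝ × ℝ | 1 - δf t < q'.1 ∧ q'.1 < 1 ∧ |q'.2| < δf t} :=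
      (isOpen_lt continuous_const continuous_fst).inter
        ((isOpen_lt continuous_fst continuous_const).inter
          (isOpen_lt (continuous_abs.comp continuous_snd) continuous_const))
    exact ho.mem_nhds ⟨hq1, hq2, hq3⟩
  have hψconst : ψ₁ t =ᶠ[𝓝 q] fun _ =>
      (T - t) ^ (-1 + 2 * γ) * ∑ k ∈ Finset.range N, ((T - t) ^ γ) ^ k * b k := by
    filter_upwards [hreg] with q' hq'
    rw [hψ t ht q' hq'.1 hq'.2.1 hq'.2.2]
    congr 1
    refine Finset.sum_congr rfl fun k _ => ?_
    rw [((hb k) _ (hYneg q' hq'.2.1)).2.2.1]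
  refine ⟨?_, ?_, ?_, ?_⟩
  · rw [hu t ht q hq1 hq2 hq3]
    have : ∑ k ∈ Finset.range N, ((T - t) ^ γ) ^ k *
        U k ((q.1 - 1) / (T - t) ^ γ, q.2 / (T - t) ^ γ) = 0 :=
      Finset.sum_eq_zero fun k _ => by rw [((hb k) _ (hYneg q hq2)).1, mul_zero]
    rw [this, mul_zero]
  · rw [hω t ht q hq1 hq2 hq3]
    have : ∑ k ∈ Finset.range N, ((T - t) ^ γ) ^ k *
        Ω k ((q.1 - 1) / (T - t) ^ γ, q.2 / (T - t) ^ γ) = 0 :=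
      Finset.sum_eq_zero fun k _ => by rw [((hb k) _ (hYneg q hq2)).2.1, mul_zero]
    rw [this, mul_zero]
  · rw [derivR_congr_nhds hψconst, derivR_const]
  · rw [derivZ_congr_nhds hψconst, derivZ_const]

end MainW

end LuoHouSeries

end Literature.Analysis.FluidPDE

end
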